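import Literature.AlgebraicGeometry.Motives.HodgeLieIdealOfConjugationStable
import Literature.AlgebraicGeometry.Motives.HodgeStructureDeligneTorusTensor
import Literature.AlgebraicGeometry.Motives.HodgeStructureTensorPolarization
import Literature.AlgebraicGeometry.Motives.SubHodgeStructureMumfordTateStable
import Literature.AlgebraicGeometry.Motives.MumfordTateGroupInternalEnd
import Literature.AlgebraicGeometry.Motives.HodgeTensorHomProofs
import Literature.AlgebraicGeometry.Motives.HodgeStructureProofs
import Literature.AlgebraicGeometry.Motives.HodgeTensorHodgeNumberProofs
import HarnessLib

/-!
# The Hodge Lie algebra normalises every `Θ`-subalgebra: a bracket-closed rational `𝔞 ⊆ End V` whose complex span contains a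
# Hodge operator is a sub-Hodge structure of `End(H)`, hence `[𝔥(H), 𝔞] ⊆ 𝔞` for polarizable `H` (GGK (I.B.5) on `End(H)`)

Family `hodge`, layer `Literature/AlgebraicGeometry/Motives`.  THEOREMS ONLY (no definition, no named fact).  Written for the
cell `pub-hodgecm2` (COR-CM), seat `b27` gen 54 (count-neutral Mumford–Tate-rank ladder, «rigidity modulo the centre», part 2).

Let `H` be a pure `ℚ`-Hodge structure of weight `n` on a finite-dimensional `V`, `Θ` its Hodge operator (`2p − n` on `V^{p,n−p}`),
and `𝔞 ⊆ End V` a rational subspace, closed under `[·,·]`, with `Θ ∈ 𝔞 ⊗ ℂ` — the «`Θ`-subalgebras» of the ladder's rigidity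
statements (`Motives/HodgeLieRigidTransport`, Moonen–Zarhin (3.1)).
* §1 `ad Θ` on `End V_ℂ`: the graded components `Y_k = Σ_p π_{p+k} Y π_p` of `Y ∈ End V_ℂ` are `ad Θ`-eigenvectors (`2k`), sum to
  `Y`, and are Lagrange polynomials in `ad Θ` applied to `Y`; so an `ad Θ`-stable complex subspace contains the graded components of
  its elements (`gradedComponent_mem_of_adTheta_stable`).
* §2 **`exists_subHodgeStructure_hom_of_theta_mem`** — `𝔞` underlies a sub-Hodge structure of the internal `End(H) = H.hom H`
  (`𝔞 ⊗ ℂ` is `ad Θ`-stable, and `Y_k ∈ Hom^{k,−k}`: it maps `V^{p,q}` to `V^{p+k,q−k}`) — Green–Griffiths–Kerr (I.B.5) «`W ⊂ T^{k,l}`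
  is a sub-Hodge structure iff `M(W) ⊆ W`», the Lie-algebra side of `⟸` for `T^{1,1} = End`.
* §3 **`commutator_mem_of_theta_mem`** — for POLARIZABLE `H`: `X A − A X ∈ 𝔞` for all `X ∈ 𝔥(H)`, `A ∈ 𝔞`: sub-Hodge structures of
  the polarizable `End(H)` are `MT(End H)(ℚ)`-stable (`SubHodgeStructure.map_mem_of_isPolarizable_of_mem_mumfordTateGroup`,
  `IsPolarizable.hom`), `f ↦ g f g⁻¹ ∈ MT(End H)(ℚ)` for `g ∈ MT(H)(ℚ)` (`arrowCongr_self_mem_mumfordTateGroup_hom`), and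
  conjugation-stability gives `ad 𝔥`-stability (`commutator_mem_of_forall_mumfordTateGroup_conj_mem_of_mem_hodgeLie`, part 1).
  Consequence (part 3, `Motives/HodgeLieRigidModuloCentre`): every `Θ`-subalgebra of `𝔥(H)` is an IDEAL of `𝔥(H)`.

## References
* [GreenGriffithsKerr2012] M. Green, P. Griffiths, M. Kerr, *Mumford–Tate Groups and Domains* (2012), §I.B (I.B.3), (I.B.5).
  [cite: GreenGriffithsKerr2012, §I.B (I.B.3) and (I.B.5)]
* [MoonenZarhin1999LowDim] B. Moonen, Yu. G. Zarhin, Math. Ann. 315 (1999), §3 (3.1) [corpus: paper:arxiv-math_9901113 p. 6].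
  [cite: MoonenZarhin1999LowDim, §3 (3.1)]
* [Deligne1982HodgeCycles] P. Deligne, LNM 900 (1982), I §3.1 and Prop. 3.4. [cite: Deligne1982HodgeCycles, I §3.1 and Prop. 3.4]
* [DeligneHodgeII1971] P. Deligne, *Théorie de Hodge II*, 1.1.6, 1.2.5. [cite: DeligneHodgeII1971, 1.1.6 and 1.2.5]
-/

noncomputable section

open scoped TensorProduct
open Polynomial

namespace Literature.AlgebraicGeometry.Motives

namespace HodgeStructure

universe u

variable {V : Type u} [AddCommGroup V] [Module ℚ V] [Module.Finite ℚ V] [HodgeTensorFacts.{u, u}] {n : ℤ}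

/-! ### §1 Graded components of a complex endomorphism are Lagrange polynomials in `ad Θ` -/

omit [Module.Finite ℚ V] [HodgeTensorFacts.{u, u}] in
/-- `x = Σ_{p ∈ P} x^{p,n−p}` for any finite `P` carrying all non-zero pieces. [cite: DeligneHodgeII1971, 1.1.6 and 1.2.5] -/
theorem sum_pieceProj_eq_of_piece_eq_bot (H : HodgeStructure V n) {P : Finset ℤ} (hP : ∀ p, p ∉ P → H.piece p (n - p) = ⊥)
    (x : ℂ ⊗[ℚ] V) : ∑ p ∈ P, H.pieceProj p x = x := by
  refine sum_pieceProj_of_subset H x fun p hp => ?_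
  by_contra hpP
  have h0 : H.pieceProj p x = 0 := by
    have hm := pieceProj_mem H p x
    rw [hP p hpP, Submodule.mem_bot] at hm
    exact hm
  exact ((mem_pieceSupport_iff H).1 hp) h0

omit [Module.Finite ℚ V] [HodgeTensorFacts.{u, u}] in
/-- The graded component `Y_k = Σ_{p ∈ P} π_{p+k} Y π_p` acts on `V^{p,n−p}` as `π_{p+k} ∘ Y`. [cite: DeligneHodgeII1971, 1.1.6 and 1.2.5] -/
theorem gradedComponent_apply_of_mem (H : HodgeStructure V n) {P : Finset ℤ} (hP : ∀ p, p ∉ P → H.piece p (n - p) = ⊥)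
    (Y : Module.End ℂ (ℂ ⊗[ℚ] V)) (k : ℤ) {p : ℤ} {x : ℂ ⊗[ℚ] V} (hx : x ∈ H.piece p (n - p)) :
    (∑ q ∈ P, H.pieceProj (q + k) ∘ₗ Y ∘ₗ H.pieceProj q) x = H.pieceProj (p + k) (Y x) := by
  classical
  rw [LinearMap.sum_apply]
  by_cases hp : p ∈ P
  · rw [Finset.sum_eq_single p]
    · rw [LinearMap.comp_apply, LinearMap.comp_apply, pieceProj_apply_of_mem H hx]
    · intro q _ hqp
      rw [LinearMap.comp_apply, LinearMap.comp_apply, pieceProj_apply_of_mem_ne H (Ne.symm hqp) hx, map_zero, map_zero]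
    · intro hpP; exact (hpP hp).elim
  · have hx0 : x = 0 := by rw [hP p hp, Submodule.mem_bot] at hx; exact hx
    subst hx0
    simp

omit [Module.Finite ℚ V] [HodgeTensorFacts.{u, u}] in
/-- **`Y_k` is an `ad Θ`-eigenvector with eigenvalue `2k`**: `Θ Y_k − Y_k Θ = 2k · Y_k`. [cite: DeligneHodgeII1971, 1.1.6 and 1.2.5] -/
theorem theta_mul_gradedComponent_sub (H : HodgeStructure V n) {P : Finset ℤ} (hP : ∀ p, p ∉ P → H.piece p (n - p) = ⊥)
    {Θ : Module.End ℂ (ℂ ⊗[ℚ] V)} (hΘ : ∀ p, ∀ x ∈ H.piece p (n - p), Θ x = ((2 * p - n : ℤ) : ℂ) • x)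
    (Y : Module.End ℂ (ℂ ⊗[ℚ] V)) (k : ℤ) :
    Θ * (∑ q ∈ P, H.pieceProj (q + k) ∘ₗ Y ∘ₗ H.pieceProj q) - (∑ q ∈ P, H.pieceProj (q + k) ∘ₗ Y ∘ₗ H.pieceProj q) * Θ =
      ((2 * k : ℤ) : ℂ) • ∑ q ∈ P, H.pieceProj (q + k) ∘ₗ Y ∘ₗ H.pieceProj q := by
  refine linearMap_ext_of_piece H fun p x hx => ?_
  rw [LinearMap.sub_apply, Module.End.mul_apply, Module.End.mul_apply, LinearMap.smul_apply, hΘ p x hx, map_smul,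
    gradedComponent_apply_of_mem H hP Y k hx,
    hΘ (p + k) _ (pieceProj_mem H (p + k) (Y x)), ← sub_smul]
  congr 1
  push_cast
  ring

omit [Module.Finite ℚ V] [HodgeTensorFacts.{u, u}] in
/-- **`Y = Σ_k Y_k`** over the (finite) set of differences `k = p′ − p`, `p, p′ ∈ P`. [cite: DeligneHodgeII1971, 1.1.6 and 1.2.5] -/
theorem sum_gradedComponent_eq (H : HodgeStructure V n) {P : Finset ℤ} (hP : ∀ p, p ∉ P → H.piece p (n - p) = ⊥)
    (Y : Module.End ℂ (ℂ ⊗[ℚ] V)) :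
    ∑ k ∈ (P ×ˢ P).image (fun q : ℤ × ℤ => q.2 - q.1), ∑ q ∈ P, H.pieceProj (q + k) ∘ₗ Y ∘ₗ H.pieceProj q = Y := by
  classical
  refine linearMap_ext_of_piece H fun p x hx => ?_
  rw [LinearMap.sum_apply]
  simp_rw [gradedComponent_apply_of_mem H hP Y _ hx]
  by_cases hp : p ∈ P
  · -- reindex `k ↦ p + k` and drop the vanishing projections
    set K := (P ×ˢ P).image (fun q : ℤ × ℤ => q.2 - q.1) with hK
    have hinj : Set.InjOn (fun k : ℤ => p + k) K := fun a _ b _ h => by simpa using h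
    rw [← Finset.sum_image (f := fun p' => H.pieceProj p' (Y x)) hinj]
    conv_rhs => rw [← sum_pieceProj_eq_of_piece_eq_bot H hP (Y x)]
    symm
    refine Finset.sum_subset (fun p' hp' => ?_) ?_
    · refine Finset.mem_image.2 ⟨p' - p, ?_, ?_⟩
      · exact Finset.mem_image.2 ⟨(p, p'), Finset.mem_product.2 ⟨hp, hp'⟩, by simp⟩
      · simp
    intro p' _ hp'
    have hm := pieceProj_mem H p' (Y x)
    rw [hP p' hp', Submodule.mem_bot] at hm
    exact hm
  · have hx0 : x = 0 := by rw [hP p hp, Submodule.mem_bot] at hx; exact hx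
    subst hx0
    simp

omit [Module.Finite ℚ V] [HodgeTensorFacts.{u, u}] in
/-- **The graded component is a Lagrange polynomial in `ad Θ` applied to `Y`.** [cite: GreenGriffithsKerr2012, §I.B (I.B.3) and (I.B.5)] -/
theorem aeval_adTheta_lagrange_eq_gradedComponent (H : HodgeStructure V n) {P : Finset ℤ} (hP : ∀ p, p ∉ P → H.piece p (n - p) = ⊥)
    {Θ : Module.End ℂ (ℂ ⊗[ℚ] V)} (hΘ : ∀ p, ∀ x ∈ H.piece p (n - p), Θ x = ((2 * p - n : ℤ) : ℂ) • x)
    (Y : Module.End ℂ (ℂ ⊗[ℚ] V)) {k : ℤ} (hk : k ∈ (P ×ˢ P).image (fun q : ℤ × ℤ => q.2 - q.1)) :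
    aeval (LinearMap.mulLeft ℂ Θ - LinearMap.mulRight ℂ Θ)
        (Lagrange.basis ((P ×ˢ P).image (fun q : ℤ × ℤ => q.2 - q.1)) (fun j : ℤ => ((2 * j : ℤ) : ℂ)) k) Y =
      ∑ q ∈ P, H.pieceProj (q + k) ∘ₗ Y ∘ₗ H.pieceProj q := by
  classical
  set K := (P ×ˢ P).image (fun q : ℤ × ℤ => q.2 - q.1) with hK
  set D : Module.End ℂ (Module.End ℂ (ℂ ⊗[ℚ] V)) := LinearMap.mulLeft ℂ Θ - LinearMap.mulRight ℂ Θ with hD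
  set L := Lagrange.basis K (fun j : ℤ => ((2 * j : ℤ) : ℂ)) k with hL
  have hinj : Set.InjOn (fun j : ℤ => ((2 * j : ℤ) : ℂ)) K := by
    intro a _ b _ h
    simp only at h
    have h' : (2 * a : ℤ) = 2 * b := by exact_mod_cast h
    omega
  conv_lhs => rw [← sum_gradedComponent_eq H hP Y]
  rw [map_sum]
  have hterm : ∀ j ∈ K, aeval D L (∑ q ∈ P, H.pieceProj (q + j) ∘ₗ Y ∘ₗ H.pieceProj q) =
      if j = k then ∑ q ∈ P, H.pieceProj (q + k) ∘ₗ Y ∘ₗ H.pieceProj q else 0 := by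
    intro j hj
    by_cases h0 : ∑ q ∈ P, H.pieceProj (q + j) ∘ₗ Y ∘ₗ H.pieceProj q = 0
    · rw [h0, map_zero]
      by_cases hjk : j = k
      · subst hjk; rw [if_pos rfl, h0]
      · rw [if_neg hjk]
    have hev : Module.End.HasEigenvector D (((2 * j : ℤ) : ℂ)) (∑ q ∈ P, H.pieceProj (q + j) ∘ₗ Y ∘ₗ H.pieceProj q) := by
      refine ⟨Module.End.mem_eigenspace_iff.2 ?_, h0⟩
      rw [hD, LinearMap.sub_apply, LinearMap.mulLeft_apply, LinearMap.mulRight_apply]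
      exact theta_mul_gradedComponent_sub H hP hΘ Y j
    rw [Module.End.aeval_apply_of_hasEigenvector hev]
    by_cases hjk : j = k
    · subst hjk
      rw [if_pos rfl, hL, Lagrange.eval_basis_self hinj hj, one_smul]
    · rw [if_neg hjk, hL, Lagrange.eval_basis_of_ne (v := fun j : ℤ => ((2 * j : ℤ) : ℂ)) (Ne.symm hjk) hj, zero_smul]
  rw [Finset.sum_congr rfl hterm, Finset.sum_ite_eq' K k, if_pos hk]

omit [Module.Finite ℚ V] [HodgeTensorFacts.{u, u}] in
/-- **An `ad Θ`-stable complex subspace of `End V_ℂ` contains the graded components of its elements.** [cite: GreenGriffithsKerr2012, §I.B (I.B.3) and (I.B.5)] -/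
theorem gradedComponent_mem_of_adTheta_stable (H : HodgeStructure V n) {P : Finset ℤ} (hP : ∀ p, p ∉ P → H.piece p (n - p) = ⊥)
    {Θ : Module.End ℂ (ℂ ⊗[ℚ] V)} (hΘ : ∀ p, ∀ x ∈ H.piece p (n - p), Θ x = ((2 * p - n : ℤ) : ℂ) • x)
    (N : Submodule ℂ (Module.End ℂ (ℂ ⊗[ℚ] V))) (hN : ∀ Y ∈ N, Θ * Y - Y * Θ ∈ N) {Y : Module.End ℂ (ℂ ⊗[ℚ] V)} (hY : Y ∈ N)
    (k : ℤ) : ∑ q ∈ P, H.pieceProj (q + k) ∘ₗ Y ∘ₗ H.pieceProj q ∈ N := by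
  classical
  by_cases hk : k ∈ (P ×ˢ P).image (fun q : ℤ × ℤ => q.2 - q.1)
  · rw [← aeval_adTheta_lagrange_eq_gradedComponent H hP hΘ Y hk]
    refine aeval_apply_mem_of_mem_invtSubmodule ((Module.End.mem_invtSubmodule _).2 fun Z hZ => ?_) _ hY
    rw [Submodule.mem_comap, LinearMap.sub_apply, LinearMap.mulLeft_apply, LinearMap.mulRight_apply]
    exact hN Z hZ
  · -- a difference not realised by two non-zero pieces: the component vanishes
    have h0 : ∑ q ∈ P, H.pieceProj (q + k) ∘ₗ Y ∘ₗ H.pieceProj q = 0 := by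
      refine linearMap_ext_of_piece H fun p x hx => ?_
      rw [gradedComponent_apply_of_mem H hP Y k hx, LinearMap.zero_apply]
      by_cases hp : p ∈ P
      · have hpk : p + k ∉ P := fun h => hk (Finset.mem_image.2 ⟨(p, p + k), Finset.mem_product.2 ⟨hp, h⟩, by ring⟩)
        have hm := pieceProj_mem H (p + k) (Y x)
        rw [hP _ hpk, Submodule.mem_bot] at hm
        exact hm
      · have hx0 : x = 0 := by rw [hP p hp, Submodule.mem_bot] at hx; exact hx
        rw [hx0, map_zero, map_zero]
    rw [h0]
    exact N.zero_mem

/-! ### §2 A `Θ`-subalgebra of `End V` is a sub-Hodge structure of `End(H)` -/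

omit [Module.Finite ℚ V] [HodgeTensorFacts.{u, u}] in
/-- The complex span of a bracket-closed rational subspace is bracket-closed. [cite: MoonenZarhin1999LowDim, §3 (3.1)] -/
theorem commutator_mem_spanC_of_bracket (𝔞 : Submodule ℚ (Module.End ℚ V)) (hbr : ∀ X ∈ 𝔞, ∀ Y ∈ 𝔞, X * Y - Y * X ∈ 𝔞)
    {Y Z : Module.End ℂ (ℂ ⊗[ℚ] V)}
    (hY : Y ∈ Submodule.span ℂ ((fun X : Module.End ℚ V => X.baseChange ℂ) '' (𝔞 : Set (Module.End ℚ V))))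
    (hZ : Z ∈ Submodule.span ℂ ((fun X : Module.End ℚ V => X.baseChange ℂ) '' (𝔞 : Set (Module.End ℚ V)))) :
    Y * Z - Z * Y ∈ Submodule.span ℂ ((fun X : Module.End ℚ V => X.baseChange ℂ) '' (𝔞 : Set (Module.End ℚ V))) := by
  induction hY using Submodule.span_induction generalizing Z with
  | mem Y hY =>
    obtain ⟨X, hX, rfl⟩ := hY
    induction hZ using Submodule.span_induction with
    | mem Z hZ =>
      obtain ⟨X', hX', rfl⟩ := hZ
      refine Submodule.subset_span ⟨X * X' - X' * X, hbr X hX X' hX', ?_⟩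
      simp only [LinearMap.baseChange_sub, Module.End.mul_eq_comp, LinearMap.baseChange_comp]
    | zero => simp
    | add Z Z' _ _ hZ hZ' => rw [mul_add, add_mul, add_sub_add_comm]; exact Submodule.add_mem _ hZ hZ'
    | smul c Z _ hZ => rw [mul_smul_comm, smul_mul_assoc, ← smul_sub]; exact Submodule.smul_mem _ c hZ
  | zero => simp
  | add Y Y' _ _ hY hY' => rw [add_mul, mul_add, add_sub_add_comm]; exact Submodule.add_mem _ (hY hZ) (hY' hZ)
  | smul c Y _ hY => rw [smul_mul_assoc, mul_smul_comm, ← smul_sub]; exact Submodule.smul_mem _ c (hY hZ)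

omit [Module.Finite ℚ V] [HodgeTensorFacts.{u, u}] in
/-- `homBaseChange` carries `𝔞 ⊗ ℂ ⊆ ℂ ⊗ End V` into the complex span of the `X_ℂ`, `X ∈ 𝔞`. [cite: DeligneHodgeII1971, 1.1.6 and 1.2.5] -/
theorem homBaseChange_mem_spanC_of_mem_baseChange (𝔞 : Submodule ℚ (Module.End ℚ V)) {ξ : ℂ ⊗[ℚ] (V →ₗ[ℚ] V)}
    (hξ : ξ ∈ 𝔞.baseChange ℂ) :
    homBaseChange V V ξ ∈ Submodule.span ℂ ((fun X : Module.End ℚ V => X.baseChange ℂ) '' (𝔞 : Set (Module.End ℚ V))) := by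
  rw [Submodule.baseChange_eq_span] at hξ
  induction hξ using Submodule.span_induction with
  | mem x hx =>
    obtain ⟨X, hX, rfl⟩ := hx
    rw [TensorProduct.mk_apply, homBaseChange_tmul, one_smul]
    exact Submodule.subset_span ⟨X, hX, rfl⟩
  | zero => simp
  | add x y _ _ hx hy => rw [map_add]; exact Submodule.add_mem _ hx hy
  | smul c x _ hx => rw [map_smul]; exact Submodule.smul_mem _ c hx

omit [Module.Finite ℚ V] [HodgeTensorFacts.{u, u}] in
/-- Conversely every element of the complex span of the `X_ℂ`, `X ∈ 𝔞`, is `homBaseChange ξ` with `ξ ∈ 𝔞 ⊗ ℂ`. [cite: DeligneHodgeII1971, 1.1.6 and 1.2.5] -/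
theorem exists_mem_baseChange_homBaseChange_eq (𝔞 : Submodule ℚ (Module.End ℚ V)) {Y : Module.End ℂ (ℂ ⊗[ℚ] V)}
    (hY : Y ∈ Submodule.span ℂ ((fun X : Module.End ℚ V => X.baseChange ℂ) '' (𝔞 : Set (Module.End ℚ V)))) :
    ∃ ξ ∈ 𝔞.baseChange ℂ, homBaseChange V V ξ = Y := by
  induction hY using Submodule.span_induction with
  | mem Y hY =>
    obtain ⟨X, hX, rfl⟩ := hY
    exact ⟨(1 : ℂ) ⊗ₜ[ℚ] X, Submodule.tmul_mem_baseChange_of_mem 1 hX, by rw [homBaseChange_tmul, one_smul]⟩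
  | zero => exact ⟨0, Submodule.zero_mem _, map_zero _⟩
  | add Y Y' _ _ hY hY' =>
    obtain ⟨ξ, hξ, rfl⟩ := hY
    obtain ⟨ξ', hξ', rfl⟩ := hY'
    exact ⟨ξ + ξ', Submodule.add_mem _ hξ hξ', map_add _ _ _⟩
  | smul c Y _ hY =>
    obtain ⟨ξ, hξ, rfl⟩ := hY
    exact ⟨c • ξ, Submodule.smul_mem _ c hξ, map_smul _ _ _⟩

omit [Module.Finite ℚ V] [HodgeTensorFacts.{u, u}] in
/-- On `F^a` the Hodge projections `π_j`, `j < a`, vanish. [cite: DeligneHodgeII1971, 1.1.6 and 1.2.5] -/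
theorem pieceProj_eq_zero_of_mem_F_of_lt (H : HodgeStructure V n) {a j : ℤ} (hja : j < a) {x : ℂ ⊗[ℚ] V} (hx : x ∈ H.F a) :
    H.pieceProj j x = 0 := by
  rw [F_eq_iSup_piece_holds H a] at hx
  induction hx using Submodule.iSup_induction' with
  | mem i x hx =>
    induction hx using Submodule.iSup_induction' with
    | mem hi x hx => exact pieceProj_apply_of_mem_ne H (by omega) hx
    | zero => exact map_zero _
    | add x y _ _ hx hy => rw [map_add, hx, hy, add_zero]
  | zero => exact map_zero _
  | add x y _ _ hx hy => rw [map_add, hx, hy, add_zero]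

omit [Module.Finite ℚ V] [HodgeTensorFacts.{u, u}] in
/-- The graded component `Y_k` maps `F^a` into `F^{a+k}`. [cite: DeligneHodgeII1971, 1.1.6 and 1.2.5] -/
theorem gradedComponent_apply_mem_F (H : HodgeStructure V n) (P : Finset ℤ)
    (Y : Module.End ℂ (ℂ ⊗[ℚ] V)) (k : ℤ) {a : ℤ} {x : ℂ ⊗[ℚ] V} (hx : x ∈ H.F a) :
    (∑ q ∈ P, H.pieceProj (q + k) ∘ₗ Y ∘ₗ H.pieceProj q) x ∈ H.F (a + k) := by
  rw [LinearMap.sum_apply]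
  refine Submodule.sum_mem _ fun q _ => ?_
  rw [LinearMap.comp_apply, LinearMap.comp_apply]
  by_cases hqa : q < a
  · rw [pieceProj_eq_zero_of_mem_F_of_lt H hqa hx, map_zero, map_zero]; exact Submodule.zero_mem _
  · exact H.antitone_F (show a + k ≤ q + k by omega) (piece_le_F H _ _ (pieceProj_mem H (q + k) _))

omit [Module.Finite ℚ V] [HodgeTensorFacts.{u, u}] in
/-- … and `x ↦ conj (Y_k (conj x))` maps `F^a` into `F^{a−k}`. [cite: DeligneHodgeII1971, 1.1.6 and 1.2.5] -/
theorem conj_gradedComponent_conj_mem_F (H : HodgeStructure V n) (P : Finset ℤ)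
    (Y : Module.End ℂ (ℂ ⊗[ℚ] V)) (k : ℤ) {a : ℤ} {x : ℂ ⊗[ℚ] V} (hx : x ∈ H.F a) :
    conj ((∑ q ∈ P, H.pieceProj (q + k) ∘ₗ Y ∘ₗ H.pieceProj q) (conj x)) ∈ H.F (a - k) := by
  rw [LinearMap.sum_apply, map_sum]
  refine Submodule.sum_mem _ fun q _ => ?_
  rw [LinearMap.comp_apply, LinearMap.comp_apply]
  have hq : H.pieceProj q (conj x) = conj (H.pieceProj (n - q) x) := by
    rw [conj_pieceProj, show n - (n - q) = q by ring]
  by_cases hqa : n - q < a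
  · rw [hq, pieceProj_eq_zero_of_mem_F_of_lt H hqa hx, map_zero, map_zero, map_zero, map_zero]; exact Submodule.zero_mem _
  · rw [conj_pieceProj]
    exact H.antitone_F (show a - k ≤ n - (q + k) by omega) (piece_le_F H _ _ (pieceProj_mem H _ _))

/-- **A `Θ`-subalgebra of `End V` underlies a sub-Hodge structure of `End(H) = H.hom H`**: for a bracket-closed rational
`𝔞 ⊆ End V` whose complex span contains a Hodge operator of `H`, `𝔞 ⊗ ℂ = ⊕_k (𝔞 ⊗ ℂ) ∩ Hom^{k,−k}` (`ad Θ`-stability and the Lagrange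
polynomials of §1), so `𝔞` is a sub-Hodge structure (Green–Griffiths–Kerr (I.B.5), the direction «`Θ`-stable ⟹ sub-Hodge structure» on
`T^{1,1} = End`). [cite: GreenGriffithsKerr2012, §I.B (I.B.3) and (I.B.5)] [cite: MoonenZarhin1999LowDim, §3 (3.1)] -/
theorem exists_subHodgeStructure_hom_of_theta_mem (H : HodgeStructure V n) (𝔞 : Submodule ℚ (Module.End ℚ V))
    (hbr : ∀ X ∈ 𝔞, ∀ Y ∈ 𝔞, X * Y - Y * X ∈ 𝔞)
    (hΘ : ∃ Θ ∈ Submodule.span ℂ ((fun X : Module.End ℚ V => X.baseChange ℂ) '' (𝔞 : Set (Module.End ℚ V))),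
      ∀ p, ∀ x ∈ H.piece p (n - p), Θ x = ((2 * p - n : ℤ) : ℂ) • x) :
    ∃ S : SubHodgeStructure (H.hom H), S.toSubmodule = 𝔞 := by
  classical
  obtain ⟨Θ, hΘN, hΘ⟩ := hΘ
  obtain ⟨P, hP⟩ := exists_finset_piece_eq_bot H
  set N := Submodule.span ℂ ((fun X : Module.End ℚ V => X.baseChange ℂ) '' (𝔞 : Set (Module.End ℚ V))) with hN
  have hNst : ∀ Y ∈ N, Θ * Y - Y * Θ ∈ N := fun Y hY => commutator_mem_spanC_of_bracket 𝔞 hbr hΘN hY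
  set K := (P ×ˢ P).image (fun q : ℤ × ℤ => q.2 - q.1) with hK
  refine SubHodgeStructure.exists_eq_of_baseChange_le 𝔞 fun ξ hξ => ?_
  set Y := homBaseChange V V ξ with hYdef
  have hYN : Y ∈ N := homBaseChange_mem_spanC_of_mem_baseChange 𝔞 hξ
  -- the graded components `Y_k`, `k ∈ K`, come from `𝔞 ⊗ ℂ`
  have hcomp : ∀ k, ∃ ξk ∈ 𝔞.baseChange ℂ, homBaseChange V V ξk = ∑ q ∈ P, H.pieceProj (q + k) ∘ₗ Y ∘ₗ H.pieceProj q :=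
    fun k => exists_mem_baseChange_homBaseChange_eq 𝔞 (gradedComponent_mem_of_adTheta_stable H hP hΘ N hNst hYN k)
  choose ξc hξc hξcY using hcomp
  have hsum : ξ = ∑ k ∈ K, ξc k := by
    apply (homBaseChange_bijective (V := V) (W := V)).1
    rw [map_sum]
    simp_rw [hξcY]
    rw [sum_gradedComponent_eq H hP Y]
  rw [hsum]
  refine Submodule.sum_mem _ fun k _ => Submodule.mem_iSup_of_mem k ⟨hξc k, ?_⟩
  -- `ξc k ∈ Hom^{k, (n - n) - k}`
  rw [SetLike.mem_coe, mem_piece_iff _ (show k + (n - n - k) = n - n by ring)]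
  simp only [hom_F, mem_homFiltration_iff]
  refine ⟨fun a x hx => ?_, fun a x hx => ?_⟩
  · rw [hξcY]
    exact gradedComponent_apply_mem_F H P Y k hx
  · rw [homBaseChange_conj_apply, hξcY, show a + (n - n - k) = a - k by ring]
    exact conj_gradedComponent_conj_mem_F H P Y k hx

/-! ### §3 For polarizable `H`: `[𝔥(H), 𝔞] ⊆ 𝔞` -/

/-- **The Hodge Lie algebra normalises every `Θ`-subalgebra**: for a POLARIZABLE pure `ℚ`-Hodge structure `H` and a bracket-closed
rational `𝔞 ⊆ End V` whose complex span contains a Hodge operator, `X A − A X ∈ 𝔞` for all `X ∈ 𝔥(H)`, `A ∈ 𝔞`.  `𝔞` is a sub-Hodge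
structure of the polarizable `End(H)` (§2, `IsPolarizable.hom`), hence stable under `MT(End H)(ℚ) ∋ (f ↦ g f g⁻¹)`, `g ∈ MT(H)(ℚ)`
(`SubHodgeStructure.map_mem_of_isPolarizable_of_mem_mumfordTateGroup`, `arrowCongr_self_mem_mumfordTateGroup_hom`), and conjugation
stability under `MT(H)(ℚ)` gives `ad 𝔥(H)`-stability (part 1). [cite: GreenGriffithsKerr2012, §I.B (I.B.3) and (I.B.5)]
[cite: MoonenZarhin1999LowDim, §3 (3.1)] [cite: Deligne1982HodgeCycles, I §3.1 and Prop. 3.4] -/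
theorem commutator_mem_of_theta_mem (H : HodgeStructure V n) (hH : H.IsPolarizable) (𝔞 : Submodule ℚ (Module.End ℚ V))
    (hbr : ∀ X ∈ 𝔞, ∀ Y ∈ 𝔞, X * Y - Y * X ∈ 𝔞)
    (hΘ : ∃ Θ ∈ Submodule.span ℂ ((fun X : Module.End ℚ V => X.baseChange ℂ) '' (𝔞 : Set (Module.End ℚ V))),
      ∀ p, ∀ x ∈ H.piece p (n - p), Θ x = ((2 * p - n : ℤ) : ℂ) • x)
    {X : Module.End ℚ V} (hX : X ∈ H.hodgeLie) {A : Module.End ℚ V} (hA : A ∈ 𝔞) : X * A - A * X ∈ 𝔞 := by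
  obtain ⟨S, hS⟩ := exists_subHodgeStructure_hom_of_theta_mem H 𝔞 hbr hΘ
  have hpol : (H.hom H).IsPolarizable := hH.hom hH
  refine commutator_mem_of_forall_mumfordTateGroup_conj_mem_of_mem_hodgeLie H 𝔞 (fun g hg B hB => ?_) hX hA
  have hmem := SubHodgeStructure.map_mem_of_isPolarizable_of_mem_mumfordTateGroup hpol S (arrowCongr_self_mem_mumfordTateGroup_hom hg)
    (x := B) (hS.symm ▸ hB)
  rw [hS] at hmem
  have he : LinearEquiv.arrowCongr g g B = (g : V →ₗ[ℚ] V) ∘ₗ B ∘ₗ (g.symm : V →ₗ[ℚ] V) :=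
    LinearMap.ext fun v => by simp [LinearEquiv.arrowCongr_apply]
  rwa [he] at hmem

/-- **… so every `Θ`-subalgebra `𝔞 ⊆ 𝔥(H)` is an IDEAL of `𝔥(H)`** (polarizable `H`). [cite: MoonenZarhin1999LowDim, §3 (3.1)]
[cite: GreenGriffithsKerr2012, §I.B (I.B.3) and (I.B.5)] -/
theorem commutator_mem_of_theta_mem' (H : HodgeStructure V n) (hH : H.IsPolarizable) (𝔞 : Submodule ℚ (Module.End ℚ V))
    (hbr : ∀ X ∈ 𝔞, ∀ Y ∈ 𝔞, X * Y - Y * X ∈ 𝔞)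
    (hΘ : ∃ Θ ∈ Submodule.span ℂ ((fun X : Module.End ℚ V => X.baseChange ℂ) '' (𝔞 : Set (Module.End ℚ V))),
      ∀ p, ∀ x ∈ H.piece p (n - p), Θ x = ((2 * p - n : ℤ) : ℂ) • x)
    {X : Module.End ℚ V} (hX : X ∈ H.hodgeLie) {A : Module.End ℚ V} (hA : A ∈ 𝔞) : A * X - X * A ∈ 𝔞 := by
  have h := 𝔞.neg_mem (commutator_mem_of_theta_mem H hH 𝔞 hbr hΘ hX hA)
  rwa [neg_sub] at h

end HodgeStructure

end Literature.AlgebraicGeometry.Motives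

end
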